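import Summits.Ventures.PercRepro.SingleMergeDim
import Summits.Ventures.PercRepro.MarkedMerge
import Summits.Ventures.PercRepro.Minor
import Summits.Ventures.PercRepro.CubeSum

/-!
# PercRepro — LINE C: contraction monotonicity of `CS_B` for single-merge maps gives Lemma B, hence C-005 (typer-2, gen 4)

ASSIGNMENTS v29 (typer-2 (c′)): the abstract induction frame of LINE C. For a cube map
`c : Config S → Setoid (Fin 4)` the Lemma-B class sum is `CS_B(c) = Σ_ρ K_N(c ρ, c ρᶜ)` (the kernel
of `N(c, c)`, `FaceGrouping.lean`); the TOP FACET at a coordinate `k` is the map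
`facetTop c k : Config {s // s ≠ k} → Setoid (Fin 4)`, `σ ↦ c (σ with x_k = 1)`, again a single-merge
map (p4's `SingleMergeMap`, `SingleMergeDim.lean`).

* **`SingleMergeContractionMono`** — `CS_B(facetTop c k) ≤ CS_B(c)` for every single-merge map and
  every coordinate (the lead's (MC_B), exhaustive at `d ≤ 5`, SAT-UNSAT at `d = 6, 7`);
* **`lemmaB_singleMerge_of_contractionMono`** — it gives `0 ≤ CS_B(c)` for every single-merge map,
  by induction on the dimension `card S` (base: the 0-cube, where the antipodal sum is the diagonal
  `K_N(σ, σ) = 0`);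
* `singleMergeMap_class` — every class map `ρ ↦ Π(embed u v ρ)` of a marked multigraph is a
  single-merge map (typer-1's `markedPartition_update_true`); **`C005_of_singleMergeLemmaB`**,
  **`C005_of_contractionMono`** — so `(MC_B)` for all dimensions closes C-005.
-/

namespace PercRepro

open Finset

section Facet

variable {S ι : Type*} [DecidableEq S]

/-- Extend a configuration of the cube without the coordinate `k` by the value `b` at `k`. -/
def extendAt (k : S) (b : Bool) (σ : Config {s // s ≠ k}) : Config S :=
  fun s => if h : s = k then b else σ ⟨s, h⟩

/-- `extendAt` at the coordinate `k`. -/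
theorem extendAt_self (k : S) (b : Bool) (σ : Config {s // s ≠ k}) : extendAt k b σ k = b := by
  simp [extendAt]

/-- `extendAt` off the coordinate `k`. -/
theorem extendAt_of_ne (k : S) (b : Bool) (σ : Config {s // s ≠ k}) {s : S} (h : s ≠ k) :
    extendAt k b σ s = σ ⟨s, h⟩ := by
  simp [extendAt, h]

/-- `extendAt` commutes with updating a coordinate other than `k`. -/
theorem extendAt_update (k : S) (b : Bool) (σ : Config {s // s ≠ k}) (e : {s // s ≠ k})
    (c : Bool) :
    extendAt k b (Function.update σ e c) = Function.update (extendAt k b σ) e.1 c := by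
  funext s
  by_cases hs : s = k
  · subst hs
    rw [extendAt_self, Function.update_of_ne e.2.symm, extendAt_self]
  · rw [extendAt_of_ne k b _ hs]
    by_cases hse : s = e.1
    · have : (⟨s, hs⟩ : {s // s ≠ k}) = e := Subtype.ext hse
      rw [this, Function.update_self, hse, Function.update_self]
    · rw [Function.update_of_ne (fun h => hse (congrArg Subtype.val h)), Function.update_of_ne hse,
        extendAt_of_ne k b σ hs]

/-- The TOP FACET `x_k = 1` of a cube map, as a map on the cube of the other coordinates. -/
def facetTop (c : Config S → ι) (k : S) : Config {s // s ≠ k} → ι :=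
  fun σ => c (extendAt k true σ)

end Facet

section CubeSumB

variable {S : Type*} [Fintype S] [DecidableEq S]

/-- The Lemma-B class sum `CS_B` of a cube map: the ordered antipodal sum of the kernel of
`N(c, c)`. -/
noncomputable abbrev cubeSumB (c : Config S → Setoid (Fin 4)) : ℝ := cubeSum nestedKernel c

omit [Fintype S] in
/-- The top facet of a single-merge map is a single-merge map. -/
theorem facetTop_singleMergeMap {c : Config S → Setoid (Fin 4)} (hc : SingleMergeMap c) (k : S) :
    SingleMergeMap (facetTop c k) := by
  intro σ e he
  have h := hc (extendAt k true σ) e.1 (by rw [extendAt_of_ne k true σ e.2]; exact he)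
  unfold facetTop
  rw [extendAt_update]
  exact h

end CubeSumB

/-- `⊤ ≠ ⊥` on the partitions of four marks. -/
theorem Setoid.top_ne_bot_fin4 : (⊤ : Setoid (Fin 4)) ≠ ⊥ := by
  intro h
  have h01 : (⊥ : Setoid (Fin 4)) 0 1 := by
    rw [← h]
    exact Setoid.eq_top_iff.mp rfl 0 1
  rw [Setoid.bot_def] at h01
  exact absurd h01 (by decide)

open Classical in
/-- The kernel of `N` vanishes on the diagonal. -/
theorem nestedKernel_self (σ : Setoid (Fin 4)) : nestedKernel σ σ = 0 := by
  unfold nestedKernel crossKernel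
  have htb : ¬ (σ = ⊤ ∧ σ = ⊥) := fun ⟨h1, h2⟩ => Setoid.top_ne_bot_fin4 (h1.symm.trans h2)
  rw [if_neg htb, if_neg fun h => htb ⟨h.2, h.1⟩]
  have hsum : ∀ i j : Fin 3, (if i ≠ j ∧ σ = cross4 i ∧ σ = cross4 j then (1 : ℝ) else 0) = 0 := by
    intro i j
    rw [if_neg]
    rintro ⟨hij, h1, h2⟩
    exact hij (cross4_injective (h1.symm.trans h2))
  simp [hsum]

/-- **Contraction monotonicity of `CS_B` for single-merge maps** (the lead's (MC_B), LINE C):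
restricting to any top facet does not increase the Lemma-B class sum. -/
def SingleMergeContractionMono : Prop :=
  ∀ {S : Type} [Fintype S] [DecidableEq S] (c : Config S → Setoid (Fin 4)), SingleMergeMap c →
    ∀ k : S, cubeSumB (facetTop c k) ≤ cubeSumB c

/-- **The LINE C frame**: contraction monotonicity gives Lemma B for every single-merge map
(induction on the dimension of the cube; the 0-cube has `CS_B = 0`). -/
theorem lemmaB_singleMerge_of_contractionMono (h : SingleMergeContractionMono) :
    ∀ {S : Type} [Fintype S] [DecidableEq S] (c : Config S → Setoid (Fin 4)), SingleMergeMap c →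
      0 ≤ cubeSumB c := by
  intro S _ _ c hc
  suffices key : ∀ n : ℕ, ∀ (S : Type) [Fintype S] [DecidableEq S], Fintype.card S = n →
      ∀ c : Config S → Setoid (Fin 4), SingleMergeMap c → 0 ≤ cubeSumB c from key _ S rfl c hc
  intro n
  induction n with
  | zero =>
    intro S _ _ hS c _
    have hempty : IsEmpty S := Fintype.card_eq_zero_iff.mp hS
    unfold cubeSumB cubeSum
    refine Finset.sum_nonneg fun ρ _ => ?_
    have hρ : ρᶜ = ρ := funext fun s => hempty.elim s
    rw [hρ, nestedKernel_self]
  | succ n ih =>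
    intro S _ _ hS c hc
    obtain ⟨k⟩ : Nonempty S := Fintype.card_pos_iff.mp (by omega)
    have hcard : Fintype.card {s // s ≠ k} = n := by
      have := Fintype.card_subtype_compl (fun s : S => s = k)
      rw [Fintype.card_subtype_eq, hS] at this
      simpa using this
    exact le_trans (ih _ hcard (facetTop c k) (facetTop_singleMergeMap hc k)) (h c hc k)

namespace MultiGraph

variable {V E : Type*} (G : MultiGraph V E) [DecidableEq E]

/-- **Every class map of a marked multigraph is a single-merge map** (one free edge merges at
most two blocks of the marked partition). -/
theorem singleMergeMap_class (m : Fin 4 → V) (u v : Config E) :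
    SingleMergeMap fun ρ : Config (Face u v) => G.markedPartition (embed u v ρ) m := by
  intro ρ e he
  show G.markedPartition (embed u v ρ) m = G.markedPartition (embed u v (Function.update ρ e true)) m ∨
    IsSingleMerge (G.markedPartition (embed u v ρ) m)
      (G.markedPartition (embed u v (Function.update ρ e true)) m)
  rw [embed_update_face u v ρ e.1 e.2 true]
  exact (G.markedPartition_update_true (embed u v ρ) e.1 m).imp Eq.symm id

end MultiGraph

/-- **Lemma B for single-merge maps gives C-005** (every face term of the two-copy sum is the class
sum of a single-merge map). -/
theorem C005_of_singleMergeLemmaB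
    (h : ∀ {S : Type} [Fintype S] [DecidableEq S] (c : Config S → Setoid (Fin 4)),
      SingleMergeMap c → 0 ≤ cubeSumB c) : C005 := by
  intro V E _ _ G p hp a b c d
  have key : 0 ≤ nestedForm p (fun ω => G.markedPartition ω ![a, b, c, d])
      (fun ω => G.markedPartition ω ![a, b, c, d]) := by
    rw [nestedForm_self_eq_sum_faces]
    refine Finset.sum_nonneg fun uv _ => ?_
    refine mul_nonneg (mul_nonneg (weight_nonneg hp _) (weight_nonneg hp _)) ?_
    split_ifs with hle
    · have hh := h _ (G.singleMergeMap_class ![a, b, c, d] uv.1 uv.2)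
      unfold cubeSumB cubeSum at hh
      exact hh
    · exact le_rfl
  rw [G.nestedForm_markedPartition] at key
  linarith

/-- **LINE C closes C-005**: contraction monotonicity of `CS_B` for single-merge maps in every
dimension gives C-005 on every finite multigraph at every `p`. -/
theorem C005_of_contractionMono (h : SingleMergeContractionMono) : C005 :=
  C005_of_singleMergeLemmaB (lemmaB_singleMerge_of_contractionMono h)

/-! ### LINE C on graphs: contraction monotonicity of the CLASS sums (no abstract maps) -/

namespace MultiGraph

variable {V E : Type*} (G : MultiGraph V E) [Fintype E] [DecidableEq E]

/-- The Lemma-B class sum of the class `(join u, meet v)` of a marked multigraph. -/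
noncomputable def faceSumB (m : Fin 4 → V) (u v : Config E) : ℝ :=
  ∑ ρ : Config (Face u v), nestedKernel (G.markedPartition (embed u v ρ) m)
    (G.markedPartition (embed u v ρᶜ) m)

/-- A class with no free edge has class sum `0` (its one configuration is its own antipode). -/
theorem faceSumB_eq_zero_of_isEmpty (m : Fin 4 → V) (u v : Config E) [IsEmpty (Face u v)] :
    G.faceSumB m u v = 0 := by
  unfold faceSumB
  refine Finset.sum_eq_zero fun ρ _ => ?_
  have hρ : ρᶜ = ρ := funext fun e => (IsEmpty.false e).elim
  rw [hρ, nestedKernel_self]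

end MultiGraph

/-- **Contraction monotonicity of the class sums of marked multigraphs** (the lead's (M) for the
Lemma-B kernel, on classes): making a free edge `e` of a class SURE does not increase `CS_B`.
This is the graph-level Line C hypothesis — it does not pass through abstract single-merge maps
(where (MC_B) fails at `d = 8`, p4 08:01:27Z). -/
def ClassContractionMono : Prop :=
  ∀ {V E : Type} [Fintype E] [DecidableEq E] (G : MultiGraph V E) (m : Fin 4 → V)
    (u v : Config E) (e : E), v e = false → u e = true →
      G.faceSumB m u (Function.update v e true) ≤ G.faceSumB m u v

/-- The face of the class with `e` made sure has one free edge fewer. -/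
theorem card_face_update_lt {E : Type*} [Fintype E] [DecidableEq E] (u v : Config E) {e : E}
    (hv : v e = false) (hu : u e = true) :
    Fintype.card (Face u (Function.update v e true)) < Fintype.card (Face u v) := by
  have hsub : ∀ x : E, (Function.update v e true x = false ∧ u x = true) → (v x = false ∧ u x = true) := by
    intro x hx
    by_cases hxe : x = e
    · subst hxe
      rw [Function.update_self] at hx
      exact absurd hx.1 (by decide)
    · rw [Function.update_of_ne hxe] at hx
      exact hx
  have hne : ¬ (Function.update v e true e = false ∧ u e = true) := by
    rw [Function.update_self]
    exact fun h => absurd h.1 (by decide)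
  calc Fintype.card (Face u (Function.update v e true))
      ≤ Fintype.card {x : E // (v x = false ∧ u x = true) ∧ x ≠ e} :=
        Fintype.card_le_of_injective (fun x => ⟨x.1, hsub x.1 x.2, fun h => by
          have := x.2; rw [h] at this; exact hne this⟩) (by
            intro x y hxy
            have h2 := congrArg Subtype.val hxy
            exact Subtype.ext h2)
    _ < Fintype.card (Face u v) := by
        have : Fintype.card {x : E // (v x = false ∧ u x = true) ∧ x ≠ e} =
            Fintype.card {x : Face u v // x.1 ≠ e} := by
          refine Fintype.card_congr ⟨fun x => ⟨⟨x.1, x.2.1⟩, x.2.2⟩, fun x => ⟨x.1.1, x.1.2, x.2⟩,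
            fun x => rfl, fun x => rfl⟩
        rw [this]
        exact Fintype.card_subtype_lt (x := (⟨e, hv, hu⟩ : Face u v)) (by simp)

/-- **The graph-level LINE C frame**: contraction monotonicity of the class sums gives Lemma B on
every class of every marked multigraph (induction on the number of free edges). -/
theorem faceSumB_nonneg_of_classContractionMono (h : ClassContractionMono) :
    ∀ {V E : Type} [Fintype E] [DecidableEq E] (G : MultiGraph V E) (m : Fin 4 → V)
      (u v : Config E), 0 ≤ G.faceSumB m u v := by
  intro V E _ _ G m u v
  suffices key : ∀ n : ℕ, ∀ (u v : Config E), Fintype.card (Face u v) = n → 0 ≤ G.faceSumB m u v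
    from key _ u v rfl
  intro n
  induction n using Nat.strong_induction_on with
  | _ n ih =>
    intro u v hcard
    by_cases hfree : ∃ e, v e = false ∧ u e = true
    · obtain ⟨e, hv, hu⟩ := hfree
      have hlt := card_face_update_lt u v hv hu
      rw [hcard] at hlt
      exact le_trans (ih _ hlt u _ rfl) (h G m u v e hv hu)
    · have : IsEmpty (Face u v) := ⟨fun x => hfree ⟨x.1, x.2⟩⟩
      rw [G.faceSumB_eq_zero_of_isEmpty m u v]

/-- **LINE C on graphs closes C-005**: contraction monotonicity of the class sums of marked
multigraphs gives C-005 on every finite multigraph at every `p`. -/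
theorem C005_of_classContractionMono (h : ClassContractionMono) : C005 := by
  intro V E _ _ G p hp a b c d
  have key : 0 ≤ nestedForm p (fun ω => G.markedPartition ω ![a, b, c, d])
      (fun ω => G.markedPartition ω ![a, b, c, d]) := by
    rw [nestedForm_self_eq_sum_faces]
    refine Finset.sum_nonneg fun uv _ => ?_
    refine mul_nonneg (mul_nonneg (weight_nonneg hp _) (weight_nonneg hp _)) ?_
    split_ifs with hle
    · exact faceSumB_nonneg_of_classContractionMono h G ![a, b, c, d] uv.1 uv.2
    · exact le_rfl
  rw [G.nestedForm_markedPartition] at key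
  linarith

end PercRepro
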